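import Mathlib
import HarnessLib.Audit.Tags
import Summits.Ventures.ResidMod.Conjectures.TwistedTorsionFamilyLaw
import Summits.Ventures.ResidMod.Conjectures.SquareClassImprimitivity
import Summits.Ventures.ResidMod.Conjectures.SquareClassGalois
import Summits.Ventures.ResidMod.Conjectures.ImprimitiveCertificates
import Summits.Ventures.ResidMod.Conjectures.ImprimitiveLinkage

/-!
# `EVEN ⊆ 2-blocks` without irreducibility (venture `ResidMod`, cell pub-residmod, TODO-29 remainder item (c))

Honest framing: elementary polynomial algebra over `ℚ` typed in Lean for the OBJECT→THEOREM census cell «pub-residmod»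
(STRUCTURE.md §4 E38 / §6 TODO-29); not a contribution to the Langlands programme, nothing deep. The statement was
declared on the cell bus before this proof was written (INBOX R302, optional support item S-9 (v), lead g13, 2026-08-23;
landing announced R304).

`ImprimitiveLinkage.lean` proves `hasTwoBlocks_of_evenAfterShift` for IRREDUCIBLE non-degenerate sextics. Referee g40
(remark R-1) observed that irreducibility is not load-bearing for the typed notion `HasTwoBlocks` (p369982), which asks
only for SOME irreducible cubic field over which `f` acquires a quadratic factor. This file removes the hypothesis:

* if the inner cubic `g` of `f(x) = g((x − t)²)` is irreducible, the registered construction over `ℚ[Y]/(g)` applies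
  verbatim (`hasTwoBlocks_of_evenAfterShift_of_irreducible`, hypotheses `f 6 ≠ 0` and `Irreducible g` only);
* otherwise `g` has a rational root `θ₀` (a reducible cubic over a field has a root:
  `Polynomial.irreducible_iff_roots_eq_zero_of_degree_le_three`), and `(x − t)² − θ₀` is a RATIONAL quadratic factor of
  `f`, visible over any cubic field — we use `ℚ[Y]/(Y³ − 2)`, certified irreducible by the `2`-adic valuation of `2`
  (`irreducible_X_cube_sub_two`).

Hence `hasTwoBlocks_of_evenAfterShift_free : f 6 ≠ 0 → EvenAfterShift f → HasTwoBlocks f`, and for every non-degenerate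
even-after-shift sextic `|Gal| ∣ 144` and no element of order `5` (`¬ Typical` was already hypothesis-free:
`evenAfterShift_not_typical'`). This matches the record: rung 23a's certificate `CUBE` flags `2BLOCK` for every `EVEN`
member, reducible or not. No `sorry`, no new axioms.
-/

open Polynomial

namespace Summit.Ventures.ResidMod.Conjectures

/-! ## EVEN ⊆ 2-blocks WITHOUT irreducibility (TODO-29 remainder item (c); referee g40 R-1) -/

/-- `Y³ − 2` is irreducible over `ℚ`: `2` has no rational cube root (its `2`-adic valuation `1` is not a multiple
of `3`). Any irreducible rational cubic would do below; this one is the cheapest to certify. -/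
theorem irreducible_X_cube_sub_two : Irreducible (X ^ 3 - C (2 : ℚ) : ℚ[X]) := by
  refine X_pow_sub_C_irreducible_of_prime Nat.prime_three (fun b hb => ?_)
  have h := congrArg (padicValRat 2) hb
  have h2 : padicValRat 2 (2 : ℚ) = 1 := by exact_mod_cast padicValRat.self (p := 2) one_lt_two
  rw [padicValRat.pow, h2] at h
  omega

/-- If the inner cubic has a RATIONAL root `θ₀`, then `(x − t)² − θ₀` is a rational quadratic factor of `f`, visible
over any cubic field — here `ℚ[Y]/(Y³ − 2)`. -/
theorem hasTwoBlocks_of_evenAfterShift_of_root {f : Sextic} {t θ₀ : ℚ} {g : ℚ[X]}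
    (hfg : toRatPoly f = g.comp ((X - C t) ^ 2)) (hθ : IsRoot g θ₀) : HasTwoBlocks f := by
  obtain ⟨g₁, hg₁⟩ : ∃ g₁ : ℚ[X], g = (X - C θ₀) * g₁ := ⟨_, (mul_divByMonic_eq_iff_isRoot.mpr hθ).symm⟩
  have hS3 : (X ^ 3 - C (2 : ℚ) : ℚ[X]).natDegree = 3 := natDegree_X_pow_sub_C
  have hq2 : ((X - C (algebraMap ℚ (AdjoinRoot (X ^ 3 - C (2 : ℚ) : ℚ[X])) t)) ^ 2 -
      C (algebraMap ℚ (AdjoinRoot (X ^ 3 - C (2 : ℚ) : ℚ[X])) θ₀)).natDegree = 2 := by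
    haveI : Fact (Irreducible (X ^ 3 - C (2 : ℚ) : ℚ[X])) := ⟨irreducible_X_cube_sub_two⟩
    exact natDegree_shiftSq_sub_C _ _
  have hfin : (toRatPoly f).map (algebraMap ℚ (AdjoinRoot (X ^ 3 - C (2 : ℚ) : ℚ[X]))) =
      ((X - C (algebraMap ℚ _ t)) ^ 2 - C (algebraMap ℚ _ θ₀)) *
        (g₁.map (algebraMap ℚ _)).comp ((X - C (algebraMap ℚ _ t)) ^ 2) := by
    rw [hfg, hg₁]
    simp only [map_comp, Polynomial.map_mul, Polynomial.map_sub, Polynomial.map_pow, map_X, map_C]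
    rw [mul_comp, sub_comp, X_comp, C_comp]
  unfold HasTwoBlocks
  exact ⟨_, hS3, irreducible_X_cube_sub_two, _, _, hq2, hfin⟩

/-- The registered construction, with only `f 6 ≠ 0` and irreducibility of the INNER cubic `g`. -/
theorem hasTwoBlocks_of_evenAfterShift_of_irreducible {f : Sextic} (hf : f 6 ≠ 0) {t : ℚ} {g : ℚ[X]}
    (hfg : toRatPoly f = g.comp ((X - C t) ^ 2)) (hgirr : Irreducible g) : HasTwoBlocks f := by
  have hg3 : g.natDegree = 3 := natDegree_eq_three_of_evenAfterShift hf hfg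
  haveI : Fact (Irreducible g) := ⟨hgirr⟩
  have hroot : IsRoot (g.map (algebraMap ℚ (AdjoinRoot g))) (AdjoinRoot.root g) := AdjoinRoot.isRoot_root g
  obtain ⟨g₁, hg₁⟩ : ∃ g₁ : (AdjoinRoot g)[X],
      g.map (algebraMap ℚ (AdjoinRoot g)) = (X - C (AdjoinRoot.root g)) * g₁ :=
    ⟨_, (mul_divByMonic_eq_iff_isRoot.mpr hroot).symm⟩
  have hq2 : ((X - C (algebraMap ℚ (AdjoinRoot g) t)) ^ 2 - C (AdjoinRoot.root g)).natDegree = 2 :=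
    natDegree_shiftSq_sub_C _ _
  have hfin : (toRatPoly f).map (algebraMap ℚ (AdjoinRoot g)) =
      ((X - C (algebraMap ℚ (AdjoinRoot g) t)) ^ 2 - C (AdjoinRoot.root g)) *
        g₁.comp ((X - C (algebraMap ℚ (AdjoinRoot g) t)) ^ 2) := by
    rw [hfg, map_comp, Polynomial.map_pow, Polynomial.map_sub, map_X, map_C, hg₁, mul_comp, sub_comp, X_comp,
      C_comp]
  unfold HasTwoBlocks
  exact ⟨g, hg3, hgirr, _, _, hq2, hfin⟩

/-- **PROVED (EVEN ⊆ 2-blocks, hypothesis-free; TODO-29 remainder item (c), referee g40 remark R-1).** Every genuine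
sextic (`f 6 ≠ 0`) that is even after a rational shift satisfies `HasTwoBlocks` — irreducibility of `f` is not needed:
if the inner cubic `g` is irreducible, use the cubic field `ℚ[Y]/(g)`; otherwise `g` has a rational root `θ₀`
(`irreducible_iff_roots_eq_zero_of_degree_le_three`) and `(x − t)² − θ₀` is already a rational quadratic factor. -/
theorem hasTwoBlocks_of_evenAfterShift_free {f : Sextic} (hf : f 6 ≠ 0) (h : EvenAfterShift f) : HasTwoBlocks f := by
  classical
  obtain ⟨t, g, -, hfg⟩ := h
  have hg3 : g.natDegree = 3 := natDegree_eq_three_of_evenAfterShift hf hfg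
  by_cases hgirr : Irreducible g
  · exact hasTwoBlocks_of_evenAfterShift_of_irreducible hf hfg hgirr
  · have hg0 : g ≠ 0 := by
      rintro rfl
      simp at hg3
    have hroots : g.roots ≠ 0 := fun h0 =>
      hgirr ((irreducible_iff_roots_eq_zero_of_degree_le_three (by omega) (by omega)).mpr h0)
    obtain ⟨θ₀, hmem⟩ := Multiset.exists_mem_of_ne_zero hroots
    exact hasTwoBlocks_of_evenAfterShift_of_root hfg ((mem_roots hg0).mp hmem)

/-- Corollaries for every non-degenerate even-after-shift sextic, irreducible or not: `|Gal| ∣ 144`, no element of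
order `5` (`¬ Typical` was already hypothesis-free: `evenAfterShift_not_typical'`). -/
theorem evenAfterShift_card_dvd' {f : Sextic} (hnd : NonDegenerate f) (h : EvenAfterShift f) :
    Nat.card (toRatPoly f).Gal ∣ 144 :=
  M23_twoBlocks_card_dvd f hnd (hasTwoBlocks_of_evenAfterShift_free hnd.1 h)

/-- … and no element of order `5` in the Galois group, for every non-degenerate even-after-shift sextic. -/
theorem evenAfterShift_orderOf_ne_five' {f : Sextic} (hnd : NonDegenerate f) (h : EvenAfterShift f)
    (σ : (toRatPoly f).Gal) : orderOf σ ≠ 5 :=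
  M23_orderOf_ne_five hnd (Or.inr (hasTwoBlocks_of_evenAfterShift_free hnd.1 h)) σ

end Summit.Ventures.ResidMod.Conjectures
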